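import Summits.BirchSwinnertonDyer.BirchSwinnertonDyer.Theorems.GoldfeldAllTwistsTwoConverseTwinAdditiveTamagawaProduct
import Literature.NumberTheory.EllipticCurves.SzpiroLocalDataProofs
import Literature.NumberTheory.EllipticCurves.DegreeConjectureAbcPrelims
import Literature.NumberTheory.DiophantineGeometry.LocalReductionProofs
import HarnessLib

set_option linter.dupNamespace false -- `…BirchSwinnertonDyer.BirchSwinnertonDyer…` is the cell's namespace (D-0017)
set_option autoImplicit false

/-!
# Twin″ (item 19140), LINE U′ file U3a: the Tamagawa product of the GOOD-at-`2` twists `49a1^{(d)}`,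
# `d ≡ 1 (mod 4)` squarefree, `7 ∤ d` — **`∏_p c_p = 2 · ∏_{ℓ ∣ d} c_ℓ`**, `c_ℓ = 2 / 4` by `(ℓ/7) = ∓1`;
# in particular **`Tam(49a1^{(ℓ)}) = 8` for a prime `ℓ ≡ 1 (mod 4)` SPLIT in `ℚ(√−7)`**

Cell `bsd-goldfeld`, seat `bsd-goldfeld-s1p-c301` (prover, gen 15); planner ORDER (clxv)/(clxvi) «LINE U′», file U3a
(`…TwinSplitTwistTamagawa`), blueprint `HOME/INERT7-UNIT-CIRCLE.md` v4 §6′. Support for item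
`stmt-BirchSwinnertonDyer-19140` (crux twin″ `BSDTwoCMSevenAdditiveRankOne`); Theses-free; theorems only; no `sorry`,
no new definition, no named fact. HONEST FRAMING: local arithmetic of an explicit family of Weierstrass models
(Tate's algorithm read on minimal models); nothing about `L`-values; no case of twin″ is decided; BSD is not proved by
any of this. It is the split / good-at-`2` twin of the additive-cell law `tamagawaProduct_cellTwist` (file V,
`d ≢ 1 (mod 4)`, `c₂ = 4`) and of Coates–Li–Tian–Zhai's bookkeeping «`c₇ = 2`, `c_{q_i} = 2`» behind
`thm44_ord_two_LAlg` (inert primes); LINE U′ needs the SPLIT prime `ℓ` (`c_ℓ = 4`) for the partner `L`-value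
`ord₂ L^{alg}(49a1^{(ℓ)}, 1) = 1` (file U3b).

WHAT IS PROVED (`d = 4k + 1`).
* §0 The integer model **`G_k = [1, −3k−1, 0, −2d², −d³]`** of `49a1^{(d)}`: `(1, 0, −½, 0) • (G_k ⊗ ℚ) = X₀(49)^{(d)}`
  (completing the square), `Δ(G_k) = −7³d⁶` (ODD: good reduction at `2`), `p¹² ∤ Δ` for every prime `p` when `d` is
  squarefree, hence **`G_k ⊗ ℚ` is a global minimal model** (Silverman VII.1 Rem. 1.1 at every place); and
  `X₀(49)^{(4d)}` has good reduction at every place `v ∤ 7d`.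
* §1 The odd places `ℓ ∣ d`, `ℓ ≠ 7`, for EVERY squarefree `d` (the hypothesis `d ≢ 1 (mod 4)` of file II's
  `localTamagawaNumber_padic_cellModel_eq_two/four` removed): the `ℤ_ℓ`-model `[0, −3d, 0, −32d², −64d³]` is minimal at
  `ℓ` because `ord_ℓ(2¹²7³d⁶) ≤ 9 < 12`, so file II's exact `I₀*` counts give **`c_ℓ = 2`** (`(−7/ℓ) = −1`) /
  **`c_ℓ = 4`** (`(−7/ℓ) = +1`).
* §2 **`Tam(X₀(49)^{(4d)}) = 2 · ∏_{ℓ ∈ primeFactors |d|} (2 if (ℓ/7) = −1 else 4)`** for squarefree `d ≡ 1 (mod 4)`,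
  `7 ∤ d` (`c₇ = 2` by file IV's `localTamagawaNumber_padic_cellTwist_seven`, generic in `7 ∤ d`; product formula over
  the places of `7·|d|`), and the same for EVERY model `W` of `49a1^{(d)}` (`Tam` is a `ℚ`-isomorphism invariant).
* §3 Prime twists: **`Tam(W) = 8`** for every model `W` of `49a1^{(ℓ)}`, `ℓ ≡ 1 (mod 4)` prime with `(ℓ/7) = +1`
  (`c₇·c_ℓ = 2·4`; for `(ℓ/7) = −1` the same law gives `2·2 = 4`, Coates–Li–Tian–Zhai's case `r = 1`).
References: [Tate1975] §7 case 6; [Silverman1994] IV.9.4 Steps 4 & 6, Table 4.1; [SilvermanAEC2009] VII.1 Rem. 1.1,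
VII.5 Prop. 5.1, VII.6, X.5 Cor. 5.4; [CoatesLiTianZhai2015] §4 (p. 17: `c₇ = 2, c_{q_i} = 2`).
-/

noncomputable section

open scoped Classical NumberField

open WeierstrassCurve IsDedekindDomain IsLocalRing Rat.HeightOneSpectrum
  Literature.NumberTheory.EllipticCurves Literature.NumberTheory.EllipticCurves.ModularForms
  Literature.NumberTheory.QuadraticForms
  Summit.BirchSwinnertonDyer.BirchSwinnertonDyer.Rank2Observatory.Tate
  Summit.BirchSwinnertonDyer.BirchSwinnertonDyer.Rank2Observatory.RootNumber

namespace Summit.BirchSwinnertonDyer.BirchSwinnertonDyer.Theorems.GoldfeldGoodTwists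

/-! ## §0 The good-at-`2` model `G_k = [1, −3k−1, 0, −2d², −d³]`, `d = 4k+1`, and its global minimality -/

section GoodModel

variable (k : ℤ)

/-- `Δ(G_k) = −7³·d⁶`, `d = 4k + 1`. [folklore] -/
theorem goodModel_Δ :
    (⟨1, -3 * k - 1, 0, -2 * (4 * k + 1) ^ 2, -(4 * k + 1) ^ 3⟩ : WeierstrassCurve ℤ).Δ = -(7 ^ 3 * (4 * k + 1) ^ 6) := by
  simp [WeierstrassCurve.Δ, b₂, b₄, b₆, b₈]; ring

/-- **Completing the square: `(1, 0, −½, 0) • (G_k ⊗ ℚ) = X₀(49)^{(d)}`**, `d = 4k+1` (so `G_k ⊗ ℚ ≅ 49a1^{(d)}`; at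
`k = 0` this is `completeSquare_smul_cm7`). [cite: SilvermanAEC2009, III.1 and X.5 Cor. 5.4] -/
theorem completeSquare_smul_goodModel_baseChange :
    (⟨1, 0, -(1 / 2 : ℚ), 0⟩ : VariableChange ℚ) •
        (⟨1, -3 * k - 1, 0, -2 * (4 * k + 1) ^ 2, -(4 * k + 1) ^ 3⟩ : WeierstrassCurve ℤ).baseChange ℚ =
      cm7.quadraticTwist (((4 * k + 1 : ℤ)) : ℚ) := by
  ext <;> simp [baseChange, quadraticTwist, b₂, b₄, b₆, variableChange_a₁, variableChange_a₂, variableChange_a₃,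
    variableChange_a₄, variableChange_a₆] <;> ring

/-- `(½, 0, 0, 0) • (1, 0, −½, 0) • (G_k ⊗ ℚ) = X₀(49)^{(4d)}` — the cell's working model `[0, −3d, 0, −32d², −64d³] ⊗ ℚ`.
[cite: SilvermanAEC2009, X.5 Cor. 5.4] -/
theorem smul_goodModel_baseChange_eq_cm7_quadraticTwist_four_mul :
    ((⟨(Units.mk0 (2 : ℚ) two_ne_zero)⁻¹, 0, 0, 0⟩ : VariableChange ℚ) * ⟨1, 0, -(1 / 2 : ℚ), 0⟩) •
        (⟨1, -3 * k - 1, 0, -2 * (4 * k + 1) ^ 2, -(4 * k + 1) ^ 3⟩ : WeierstrassCurve ℤ).baseChange ℚ =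
      cm7.quadraticTwist (((4 * (4 * k + 1) : ℤ)) : ℚ) := by
  rw [mul_smul, completeSquare_smul_goodModel_baseChange,
    show ((4 * (4 * k + 1) : ℤ) : ℚ) = (2 : ℚ) ^ 2 * (((4 * k + 1 : ℤ)) : ℚ) by push_cast; ring]
  exact (cm7.quadraticTwist_sq_mul two_ne_zero _).symm

variable {k}

/-- For a prime `p` and a squarefree `d`: **`p¹² ∤ 7³·d⁶`** (`ord_p ≤ 3 + 6 = 9`). [folklore] -/
theorem not_pow_twelve_dvd_of_squarefree {d : ℤ} (hsq : Squarefree d) {p : ℕ} (hp : p.Prime) :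
    ¬ (p : ℤ) ^ 12 ∣ 7 ^ 3 * d ^ 6 := by
  intro h'
  have hp' : Prime (p : ℤ) := Int.prime_iff_natAbs_prime.mpr (by simpa using hp)
  have hfin_d : FiniteMultiplicity (p : ℤ) d := Int.finiteMultiplicity_iff.mpr ⟨by exact_mod_cast hp.one_lt.ne', hsq.ne_zero⟩
  have hfin : FiniteMultiplicity (p : ℤ) (7 ^ 3 * d ^ 6) := by
    apply Int.finiteMultiplicity_iff.mpr
    refine ⟨by exact_mod_cast hp.one_lt.ne', ?_⟩
    have hd0 : d ≠ 0 := hsq.ne_zero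
    positivity
  have hle : (12 : ℕ) ≤ multiplicity (p : ℤ) (7 ^ 3 * d ^ 6) := hfin.le_multiplicity_of_pow_dvd h'
  have h7 : multiplicity (p : ℤ) ((7 : ℤ) ^ 3) ≤ 3 := by
    rw [(Int.finiteMultiplicity_iff.mpr ⟨by exact_mod_cast hp.one_lt.ne', by norm_num⟩).multiplicity_pow hp']
    have : multiplicity (p : ℤ) 7 ≤ 1 := by
      by_cases hp7 : (p : ℤ) ∣ 7
      · have : (p : ℤ) = 7 := by
          have h77 : p ∣ 7 := by exact_mod_cast hp7
          exact_mod_cast (Nat.prime_dvd_prime_iff_eq hp (by norm_num)).mp h77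
        rw [this]
        exact (multiplicity_self).le
      · rw [multiplicity_eq_zero.mpr hp7]; exact zero_le_one
    omega
  have h6 : multiplicity (p : ℤ) (d ^ 6) ≤ 6 := by
    rw [hfin_d.multiplicity_pow hp']
    have : multiplicity (p : ℤ) d ≤ 1 := by
      refine Nat.le_of_lt_succ (hfin_d.multiplicity_lt_iff_not_dvd.mpr ?_)
      intro hdd
      have := hsq (p : ℤ) (by rw [← sq]; exact hdd)
      rw [Int.isUnit_iff] at this
      have h1 := hp.one_lt
      omega
    omega
  have hmul : multiplicity (p : ℤ) (7 ^ 3 * d ^ 6) =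
      multiplicity (p : ℤ) ((7 : ℤ) ^ 3) + multiplicity (p : ℤ) (d ^ 6) := multiplicity_mul hp' hfin
  omega

/-- **`G_k ⊗ ℚ` is a GLOBAL MINIMAL MODEL of `49a1^{(d)}`** for squarefree `d = 4k+1`: `p¹² ∤ Δ = −7³d⁶` at every prime
`p` (Silverman's criterion `ord_p Δ < 12`, AEC VII.1 Rem. 1.1; VIII.8). [cite: SilvermanAEC2009, VII.1 Remark 1.1] -/
theorem isGloballyMinimal_goodModel (hsq : Squarefree (4 * k + 1)) :
    ((⟨1, -3 * k - 1, 0, -2 * (4 * k + 1) ^ 2, -(4 * k + 1) ^ 3⟩ : WeierstrassCurve ℤ).baseChange ℚ).IsGloballyMinimal := by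
  refine isGloballyMinimal_of_forall_isMinimalAt_int _ fun v => isMinimalAt_baseChange_int_of_not_pow_dvd_Δ ?_
  rw [goodModel_Δ, dvd_neg]
  exact not_pow_twelve_dvd_of_squarefree hsq (prime_natGenerator v)

/-- A prime dividing `Δ(G_k) = −7³d⁶` is `7` or divides `d`. [folklore] -/
theorem dvd_of_prime_dvd_goodModel_Δ {p : ℕ} (hp : p.Prime)
    (h : (p : ℤ) ∣ (⟨1, -3 * k - 1, 0, -2 * (4 * k + 1) ^ 2, -(4 * k + 1) ^ 3⟩ : WeierstrassCurve ℤ).Δ) :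
    p = 7 ∨ (p : ℤ) ∣ 4 * k + 1 := by
  rw [goodModel_Δ, dvd_neg] at h
  have hp' : Prime (p : ℤ) := Int.prime_iff_natAbs_prime.mpr (by simpa using hp)
  rcases hp'.dvd_or_dvd h with h1 | h1
  · left
    have h3 : (p : ℤ) ∣ 7 := hp'.dvd_of_dvd_pow h1
    have h4 : p ∣ 7 := by exact_mod_cast h3
    exact (Nat.prime_dvd_prime_iff_eq hp (by norm_num)).mp h4
  · exact Or.inr (hp'.dvd_of_dvd_pow h1)

/-- **`X₀(49)^{(4d)}` has GOOD REDUCTION at every place `v ∤ 7d`**, `d = 4k+1` (in particular at `2`): it is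
`ℚ`-isomorphic to `G_k ⊗ ℚ`, whose discriminant `−7³d⁶` is a `v`-unit (AEC VII.5.1(a); good reduction is a
`ℚ`-isomorphism invariant). [cite: SilvermanAEC2009, VII.5 Prop. 5.1(a) and VII.1 Prop. 1.3(b)] -/
theorem hasGoodReductionAt_cm7_quadraticTwist_four_mul_of_not_dvd (v : HeightOneSpectrum ℤ)
    (hv : ¬ ((natGenerator v : ℤ) ∣ 7 * (4 * k + 1))) :
    (cm7.quadraticTwist (((4 * (4 * k + 1) : ℤ)) : ℚ)).HasGoodReductionAt v := by
  rw [← smul_goodModel_baseChange_eq_cm7_quadraticTwist_four_mul,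
    WeierstrassCurve.hasGoodReductionAt_smul_iff_holds v _ _]
  refine hasGoodReductionAt_of_not_dvd fun hdvd => hv ?_
  rcases dvd_of_prime_dvd_goodModel_Δ (prime_natGenerator v) hdvd with h | h
  · rw [h]; exact dvd_mul_right _ _
  · exact dvd_mul_of_dvd_right h _

end GoodModel

/-! ## §1 The odd places `ℓ ∣ d`, `ℓ ≠ 7`, for every squarefree `d`: `c_ℓ = 2` / `4` by `(−7/ℓ)` -/

section OddPlace

variable {d : ℤ} {l : ℕ}

/-- **The `ℤ_ℓ`-model `[0, −3d, 0, −32d², −64d³]` of `X₀(49)^{(4d)}` is MINIMAL at every odd prime `ℓ`** for squarefree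
`d` (`ord_ℓ Δ = ord_ℓ(2¹²7³d⁶) ≤ 9 < 12`; no congruence condition on `d`). [cite: SilvermanAEC2009, VII.1 Remark 1.1] -/
theorem isMinimal_cellModel_padic_of_odd (hsq : Squarefree d) [Fact l.Prime] (hl2 : l ≠ 2) :
    ((⟨0, -3 * (d : ℤ_[l]), 0, -32 * (d : ℤ_[l]) ^ 2, -64 * (d : ℤ_[l]) ^ 3⟩ :
      WeierstrassCurve ℤ_[l]).baseChange ℚ_[l]).IsMinimal ℤ_[l] := by
  have hl : l.Prime := Fact.out
  set w : HeightOneSpectrum ℤ := (primesEquiv (R := ℤ)).symm ⟨l, hl⟩ with hw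
  have hwl : ((primesEquiv w : Nat.Primes) : ℕ) = l := by rw [hw, Equiv.apply_symm_apply]
  have hgen : (natGenerator w : ℤ) = l := by
    rw [show natGenerator w = ((primesEquiv w : Nat.Primes) : ℕ) from rfl, hwl]
  have hmin : ((⟨0, -3 * d, 0, -32 * d ^ 2, -64 * d ^ 3⟩ : WeierstrassCurve ℤ).baseChange ℚ).IsMinimalAt w := by
    refine isMinimalAt_baseChange_int_of_not_pow_dvd_Δ ?_
    rw [cellModel_Δ, dvd_neg, hgen, mul_assoc]
    intro h
    have hcop2 : IsCoprime ((l : ℤ) ^ 12) ((2 : ℤ) ^ 12) := by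
      apply IsCoprime.pow
      rw [Int.isCoprime_iff_gcd_eq_one, show (2 : ℤ) = ((2 : ℕ) : ℤ) from rfl, Int.gcd_natCast_natCast]
      exact (Nat.coprime_primes hl Nat.prime_two).mpr hl2
    exact not_pow_twelve_dvd_of_squarefree hsq hl (hcop2.dvd_of_dvd_mul_left h)
  have h2 := (isMinimalAt_iff_isMinimal_padic w l hwl _).mp hmin
  rwa [cellModel_baseChange_padic] at h2

/-- **`c_ℓ(49a1^{(d)}) = 2` at an odd prime `ℓ ∣ d`, `ℓ ≠ 7`, INERT in `ℚ(√−7)`**, for EVERY squarefree `d` (on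
`X₀(49)^{(4d)} ⊗ ℚ_ℓ`). [cite: Silverman1994, IV.9.4 Step 6 and Table 4.1] [cite: Tate1975, §7 (case 6)] -/
theorem localTamagawaNumber_padic_cellModel_eq_two' (hsq : Squarefree d) [Fact l.Prime]
    (hl2 : l ≠ 2) (hl7' : l ≠ 7) (hld : (l : ℤ) ∣ d) (hl7 : legendreSym l (-7) = -1) :
    (haveI := cm7.isElliptic_quadraticTwist (show (((4 * d : ℤ)) : ℚ) ≠ 0 by
       have := hsq.ne_zero; exact_mod_cast (show (4 * d : ℤ) ≠ 0 by omega))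
     ((cm7.quadraticTwist (((4 * d : ℤ)) : ℚ)).baseChange ℚ_[l]).localTamagawaNumber ℤ_[l]) = 2 := by
  have hl : l.Prime := Fact.out
  have hd : (((4 * d : ℤ)) : ℚ) ≠ 0 := by
    have := hsq.ne_zero; exact_mod_cast (show (4 * d : ℤ) ≠ 0 by omega)
  haveI := cm7.isElliptic_quadraticTwist hd
  obtain ⟨e, hde, he⟩ := exists_eq_mul_not_dvd_of_squarefree hsq hl hld
  haveI := isMinimal_cellModel_padic_of_odd hsq hl2
  have hJ : (1 : VariableChange ℚ_[l]) • (cm7.quadraticTwist (((4 * d : ℤ)) : ℚ)).baseChange ℚ_[l] =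
      (⟨0, -3 * (d : ℤ_[l]), 0, -32 * (d : ℤ_[l]) ^ 2, -64 * (d : ℤ_[l]) ^ 3⟩ : WeierstrassCurve ℤ_[l]).baseChange
        ℚ_[l] := by
    rw [one_smul, ← cellModel_baseChange, cellModel_baseChange_padic]
  rw [LocalIndex.localTamagawaNumber_eq_index_of_smul_eq_baseChange _ _ _ hJ]
  exact index_nonsingularReductionSubgroup_cellModel_eq_two hl2 hl7' hl7 he hde

/-- **`c_ℓ(49a1^{(d)}) = 4` at an odd prime `ℓ ∣ d`, `ℓ ≠ 7`, SPLIT in `ℚ(√−7)`** (`(−7/ℓ) = +1`), for EVERY squarefree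
`d`. [cite: Silverman1994, IV.9.4 Step 6 and Table 4.1] [cite: Tate1975, §7 (case 6)] -/
theorem localTamagawaNumber_padic_cellModel_eq_four' (hsq : Squarefree d) [Fact l.Prime]
    (hl2 : l ≠ 2) (hl7' : l ≠ 7) (hld : (l : ℤ) ∣ d) (hl7 : legendreSym l (-7) = 1) :
    (haveI := cm7.isElliptic_quadraticTwist (show (((4 * d : ℤ)) : ℚ) ≠ 0 by
       have := hsq.ne_zero; exact_mod_cast (show (4 * d : ℤ) ≠ 0 by omega))
     ((cm7.quadraticTwist (((4 * d : ℤ)) : ℚ)).baseChange ℚ_[l]).localTamagawaNumber ℤ_[l]) = 4 := by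
  have hl : l.Prime := Fact.out
  have hd : (((4 * d : ℤ)) : ℚ) ≠ 0 := by
    have := hsq.ne_zero; exact_mod_cast (show (4 * d : ℤ) ≠ 0 by omega)
  haveI := cm7.isElliptic_quadraticTwist hd
  obtain ⟨e, hde, he⟩ := exists_eq_mul_not_dvd_of_squarefree hsq hl hld
  haveI := isMinimal_cellModel_padic_of_odd hsq hl2
  have hJ : (1 : VariableChange ℚ_[l]) • (cm7.quadraticTwist (((4 * d : ℤ)) : ℚ)).baseChange ℚ_[l] =
      (⟨0, -3 * (d : ℤ_[l]), 0, -32 * (d : ℤ_[l]) ^ 2, -64 * (d : ℤ_[l]) ^ 3⟩ : WeierstrassCurve ℤ_[l]).baseChange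
        ℚ_[l] := by
    rw [one_smul, ← cellModel_baseChange, cellModel_baseChange_padic]
  rw [LocalIndex.localTamagawaNumber_eq_index_of_smul_eq_baseChange _ _ _ hJ]
  exact index_nonsingularReductionSubgroup_cellModel_eq_four hl2 hl7' hl7 he hde

end OddPlace

/-! ## §2 The Tamagawa product law of the good-at-`2` twists, `d ≡ 1 (mod 4)` -/

section Product

variable {k : ℤ}

/-- The local Tamagawa number of `X₀(49)^{(4d)}`, `d = 4k+1` squarefree, `7 ∤ d`, at a prime `p ∣ 7·|d|`: `2` at `7`,
`2` / `4` at `ℓ ∣ d` by `(ℓ/7) = −1` / `+1`. [cite: Silverman1994, IV.9.4 and Table 4.1] -/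
theorem localTamagawaNumber_padic_goodTwist_of_mem_primeFactors (hsq : Squarefree (4 * k + 1))
    (h7 : ¬ (7 : ℤ) ∣ 4 * k + 1) {p : ℕ} [hp : Fact p.Prime] (hpmem : p ∈ (7 * (4 * k + 1).natAbs).primeFactors) :
    (haveI := cm7.isElliptic_quadraticTwist (show (((4 * (4 * k + 1) : ℤ)) : ℚ) ≠ 0 by
       exact_mod_cast (show (4 * (4 * k + 1) : ℤ) ≠ 0 by omega))
     ((cm7.quadraticTwist (((4 * (4 * k + 1) : ℤ)) : ℚ)).baseChange ℚ_[p]).localTamagawaNumber ℤ_[p]) =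
      if p = 7 then 2 else if jacobiSym p 7 = -1 then 2 else 4 := by
  have hpP : p.Prime := hp.out
  by_cases hp7 : p = 7
  · subst hp7
    rw [if_pos rfl]
    exact localTamagawaNumber_padic_cellTwist_seven h7
  rw [if_neg hp7]
  -- `p ≠ 7` divides `7·|d|`, hence divides `d`; `d` is odd so `p ≠ 2`
  have hpd : (p : ℤ) ∣ 4 * k + 1 := by
    have h1 : p ∣ 7 * (4 * k + 1).natAbs := Nat.dvd_of_mem_primeFactors hpmem
    rcases (Nat.Prime.dvd_mul hpP).mp h1 with h77 | hdd
    · exact absurd ((Nat.prime_dvd_prime_iff_eq hpP (by norm_num)).mp h77) hp7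
    · exact Int.natCast_dvd.mpr hdd
  have hp2 : p ≠ 2 := by
    rintro rfl
    have : (2 : ℤ) ∣ 4 * k + 1 := hpd
    omega
  have hleg : legendreSym p (-7) = jacobiSym p 7 := legendreSym_neg_seven_eq_jacobiSym hp2
  by_cases hj : jacobiSym p 7 = -1
  · rw [if_pos hj]
    exact localTamagawaNumber_padic_cellModel_eq_two' hsq hp2 hp7 hpd (by rw [hleg, hj])
  · rw [if_neg hj]
    have hj1 : jacobiSym p 7 = 1 := by
      rcases jacobiSym.eq_one_or_neg_one (a := (p : ℤ)) (b := 7) (by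
        rw [Int.gcd_natCast_natCast]
        exact (Nat.coprime_primes hpP (by norm_num)).mpr hp7) with h | h
      · exact h
      · exact (hj h).elim
    exact localTamagawaNumber_padic_cellModel_eq_four' hsq hp2 hp7 hpd (by rw [hleg, hj1])

/-- **TAMAGAWA PRODUCT LAW of the good-at-`2` twists.** For squarefree `d = 4k+1` with `7 ∤ d`:
`Tam(X₀(49)^{(4d)}) = 2 · ∏_{ℓ ∈ primeFactors |d|} (2 if (ℓ/7) = −1 else 4)` — `c₇ = 2`, `c₂ = 1` (good reduction),
`2` per inert and `4` per split prime factor of `d`. [cite: Silverman1994, IV.9.4 and Table 4.1] [cite: SilvermanAEC2009, VII.6] -/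
theorem tamagawaProduct_goodTwist (hsq : Squarefree (4 * k + 1)) (h7 : ¬ (7 : ℤ) ∣ 4 * k + 1) :
    (haveI := cm7.isElliptic_quadraticTwist (show (((4 * (4 * k + 1) : ℤ)) : ℚ) ≠ 0 by
       exact_mod_cast (show (4 * (4 * k + 1) : ℤ) ≠ 0 by omega))
     (cm7.quadraticTwist (((4 * (4 * k + 1) : ℤ)) : ℚ)).tamagawaProduct) =
      2 * ∏ l ∈ (4 * k + 1).natAbs.primeFactors, (if jacobiSym l 7 = -1 then 2 else 4) := by
  have hd0 : (4 * k + 1 : ℤ) ≠ 0 := by omega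
  have hd : (((4 * (4 * k + 1) : ℤ)) : ℚ) ≠ 0 := by exact_mod_cast (show (4 * (4 * k + 1) : ℤ) ≠ 0 by omega)
  haveI := cm7.isElliptic_quadraticTwist hd
  -- the finite set of places of `7·|d|`
  set P : Finset ℕ := (7 * (4 * k + 1).natAbs).primeFactors with hP
  have hPprime : ∀ p ∈ P, p.Prime := fun p hp => Nat.prime_of_mem_primeFactors hp
  set e : P → HeightOneSpectrum ℤ := fun p => (primesEquiv (R := ℤ)).symm ⟨p.1, hPprime p.1 p.2⟩ with he
  have he_inj : Function.Injective e := by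
    intro p q hpq
    have := congrArg (fun v => ((primesEquiv (R := ℤ)) v : ℕ)) hpq
    simp only [he, Equiv.apply_symm_apply] at this
    exact Subtype.ext this
  have he_val : ∀ p : P, (primesEquiv (e p) : ℕ) = p.1 := fun p => by simp only [he, Equiv.apply_symm_apply]
  set s : Finset (HeightOneSpectrum ℤ) := Finset.univ.image e with hs
  -- every bad place is in `s` (§0: good reduction off `7d`)
  have hprod := tamagawaProduct_eq_prod (cm7.quadraticTwist (((4 * (4 * k + 1) : ℤ)) : ℚ)) s (by
    intro v hv
    by_contra hmem
    apply hv
    refine hasGoodReductionAt_cm7_quadraticTwist_four_mul_of_not_dvd v fun hdvd => hmem ?_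
    have hmemP : natGenerator v ∈ P := by
      rw [hP, Nat.mem_primeFactors]
      refine ⟨prime_natGenerator v, ?_, by positivity⟩
      have : (natGenerator v : ℤ) ∣ ((7 * (4 * k + 1).natAbs : ℕ) : ℤ) := by
        push_cast
        rw [← Int.dvd_natAbs, Int.natAbs_mul] at hdvd
        simpa using hdvd
      exact Int.natCast_dvd_natCast.mp this
    rw [hs, Finset.mem_image]
    refine ⟨⟨natGenerator v, hmemP⟩, Finset.mem_univ _, ?_⟩
    apply (primesEquiv (R := ℤ)).injective
    rw [he]; simp only [Equiv.apply_symm_apply]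
    exact Subtype.ext rfl)
  rw [hprod, hs, Finset.prod_image (fun p _ q _ h => he_inj h)]
  -- evaluate each local factor
  have hfac : ∀ p : P, (haveI := Fact.mk (primesEquiv (e p)).2
      ((cm7.quadraticTwist (((4 * (4 * k + 1) : ℤ)) : ℚ)).baseChange ℚ_[primesEquiv (e p)]).localTamagawaNumber
        ℤ_[primesEquiv (e p)]) = (if p.1 = 7 then 2 else if jacobiSym p.1 7 = -1 then 2 else 4) := by
    intro p
    haveI : Fact p.1.Prime := ⟨hPprime p.1 p.2⟩
    refine localTamagawaNumber_padic_eq_of_forall_place _ (e p) p.1 (he_val p) _ (fun w hw => ?_)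
    rw [← localTamagawaNumber_padic_eq_holds _ w p.1 hw]
    exact localTamagawaNumber_padic_goodTwist_of_mem_primeFactors hsq h7 p.2
  rw [Finset.prod_congr rfl (fun p _ => hfac p)]
  -- back to a product over `P = {7} ∪ primeFactors |d|`
  rw [Finset.prod_coe_sort P (fun p : ℕ => (if p = 7 then 2 else if jacobiSym p 7 = -1 then 2 else 4 : ℕ))]
  have h7Q : (7 : ℕ) ∉ (4 * k + 1).natAbs.primeFactors := by
    rw [Nat.mem_primeFactors]
    rintro ⟨-, h, -⟩
    exact h7 (by exact_mod_cast (Int.ofNat_dvd_left.mpr h : ((7 : ℕ) : ℤ) ∣ 4 * k + 1))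
  have hPeq : P = insert 7 (4 * k + 1).natAbs.primeFactors := by
    rw [hP, Nat.primeFactors_mul (by norm_num) (Int.natAbs_ne_zero.mpr hd0), Nat.Prime.primeFactors (by norm_num)]
    rfl
  rw [hPeq, Finset.prod_insert h7Q, if_pos rfl]
  congr 1
  refine Finset.prod_congr rfl fun p hp => ?_
  have hp7 : p ≠ 7 := fun h => h7Q (by rwa [h] at hp)
  rw [if_neg hp7]

/-- **`∏_p c_p(W) = 2 · ∏_{ℓ ∣ d} c_ℓ` FOR EVERY MODEL `W` of `49a1^{(d)}`**, `d = 4k+1` squarefree, `7 ∤ d`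
(`C • W = X₀(49)^{(d)}`; `Tam` is a `ℚ`-isomorphism invariant and `X₀(49)^{(d)} ≅ X₀(49)^{(4d)}`).
[cite: Silverman1994, IV.9.4 and Table 4.1] [cite: SilvermanAEC2009, VII.6 and X.5 Cor. 5.4] -/
theorem tamagawaProduct_eq_of_smul_eq_cm7_quadraticTwist_of_one_mod_four (hsq : Squarefree (4 * k + 1))
    (h7 : ¬ (7 : ℤ) ∣ 4 * k + 1) (W : WeierstrassCurve ℚ) [W.IsElliptic] (C : VariableChange ℚ)
    (hC : C • W = cm7.quadraticTwist (((4 * k + 1 : ℤ)) : ℚ)) :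
    W.tamagawaProduct = 2 * ∏ l ∈ (4 * k + 1).natAbs.primeFactors, (if jacobiSym l 7 = -1 then 2 else 4) := by
  have hd : (((4 * (4 * k + 1) : ℤ)) : ℚ) ≠ 0 := by exact_mod_cast (show (4 * (4 * k + 1) : ℤ) ≠ 0 by omega)
  haveI := cm7.isElliptic_quadraticTwist hd
  obtain ⟨C', hC'⟩ := exists_smul_eq_cellModel_baseChange W hC
  rw [cellModel_baseChange] at hC'
  have h := tamagawaProduct_variableChange_eq W C'
  rw [hC'] at h
  rw [← h]
  exact tamagawaProduct_goodTwist hsq h7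

end Product

/-! ## §3 Prime twists: `Tam(49a1^{(ℓ)}) = 8` for `ℓ ≡ 1 (mod 4)` split in `ℚ(√−7)` -/

section PrimeTwist

variable {l : ℕ}

/-- A prime `ℓ ≡ 1 (mod 4)` is `4k+1` with `k = ℓ/4`, squarefree, and `(ℓ/7) = ±1 ⇒ 7 ∤ ℓ`. [folklore] -/
theorem prime_eq_four_mul_add_one (hl : l.Prime) (hl4 : l % 4 = 1) (hl7 : jacobiSym l 7 = 1 ∨ jacobiSym l 7 = -1) :
    (l : ℤ) = 4 * ((l / 4 : ℕ) : ℤ) + 1 ∧ Squarefree (4 * ((l / 4 : ℕ) : ℤ) + 1) ∧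
      ¬ (7 : ℤ) ∣ 4 * ((l / 4 : ℕ) : ℤ) + 1 := by
  have hlk : (l : ℤ) = 4 * ((l / 4 : ℕ) : ℤ) + 1 := by
    have := Nat.div_add_mod l 4
    omega
  refine ⟨hlk, ?_, ?_⟩
  · rw [← hlk]
    exact (Int.squarefree_natCast.mpr hl.squarefree)
  · rw [← hlk]
    intro h
    have h7l : (7 : ℕ) ∣ l := by exact_mod_cast h
    have hl7' : l = 7 := ((Nat.prime_dvd_prime_iff_eq (by norm_num) hl).mp h7l).symm
    subst hl7'
    rcases hl7 with h | h <;> rw [show ((7 : ℕ) : ℤ) = 7 by norm_num, jacobiSym.mod_left] at h <;> norm_num at h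

/-- **`Tam(W) = c₇ · c_ℓ = 2 · 4 = 8` for every model `W` of `49a1^{(ℓ)}`, `ℓ ≡ 1 (mod 4)` prime SPLIT in `ℚ(√−7)`**
(`(ℓ/7) = +1`): the Tamagawa input of the partner `L`-value `ord₂ L^{alg}(49a1^{(ℓ)}, 1) = 1` of LINE U′.
[cite: Silverman1994, IV.9.4 and Table 4.1] [cite: SilvermanAEC2009, VII.6] -/
theorem tamagawaProduct_eq_eight_of_smul_eq_cm7_quadraticTwist_splitPrime (hl : l.Prime) (hl4 : l % 4 = 1)
    (hl7 : jacobiSym l 7 = 1) (W : WeierstrassCurve ℚ) [W.IsElliptic] (C : VariableChange ℚ)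
    (hC : C • W = cm7.quadraticTwist (l : ℚ)) : W.tamagawaProduct = 8 := by
  obtain ⟨hlk, hsq, h7⟩ := prime_eq_four_mul_add_one hl hl4 (Or.inl hl7)
  have hC' : C • W = cm7.quadraticTwist (((4 * ((l / 4 : ℕ) : ℤ) + 1 : ℤ)) : ℚ) := by
    rw [hC, ← hlk]; push_cast; rfl
  rw [tamagawaProduct_eq_of_smul_eq_cm7_quadraticTwist_of_one_mod_four hsq h7 W C hC']
  have hnat : (4 * ((l / 4 : ℕ) : ℤ) + 1).natAbs = l := by rw [← hlk]; exact Int.natAbs_natCast l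
  rw [hnat, Nat.Prime.primeFactors hl, Finset.prod_singleton, if_neg (by rw [hl7]; norm_num)]

end PrimeTwist

end Summit.BirchSwinnertonDyer.BirchSwinnertonDyer.Theorems.GoldfeldGoodTwists

end
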